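import Literature.Probability.LatticeModels.GKSInequalities
import Literature.Probability.LatticeModels.IsingThermodynamics
import Literature.Probability.LatticeModels.ThermodynamicLimit
import HarnessLib

/-!
# `StrandShadow` (stmt-CriticalPhenomena-14626), line `Sketch`: the sponge gain IS clause (iii)

Helper file of the line lead (`--supports stmt-CriticalPhenomena-14626`).  Given the two-replica
identities of the line (`stub_replicaIdentities`: `U₄ = 8·Cov_𝒜(X,Y)`, `G₀₁ = 2E[X]`,
`G₂₃ = 2E[Y]`), the line's bet `stub_gain` (C⁺, `E[XY] ≤ (1 − c)E[X]E[Y]` on the tetrahedra at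
`β_c(3)`) is EQUIVALENT, scale by scale and with the SAME constant, to the lattice clause-(iii)
inequality `INT` (`2c·G₀₁G₂₃ ≤ G₀₁G₂₃ + G₀₂G₁₃ + G₀₃G₁₂ − ⟨σ_A⟩`, the costume form of the crux in
`Cruxes/StrandShadow/Disproof.lean`): `gain_iff_int`.  Pure algebra; recorded so that the chain
reads the line's open stub for what it is (the crux / `IndependentStrandsJoin` in sponge dress).
-/

noncomputable section

open Finset SimpleGraph Literature.Probability.LatticeModels

namespace Summit.CriticalPhenomena.Ising3DConformalLimit.Theorems.StrandShadowSketch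

open scoped Classical

section General

variable {V : Type*} [Fintype V] [DecidableEq V] (G : SimpleGraph V) [DecidableRel G.Adj]

/-- **Gain ⟺ INT at one scale** (pure algebra through the replica identities). -/
theorem gain_iff_int_core {β c : ℝ} (a : Fin 4 → V)
    (hrep : (let Zs : Finset V → ℝ := fun A =>
         isingPartitionFunction G A (2 * β) 0 .free * isingPartitionFunction G Aᶜ (2 * β) 0 .free
       let X : Finset V → ℝ := fun A =>
         if a 0 ∈ A ∧ a 1 ∈ A then isingCorr G A (2 * β) 0 .free {a 0, a 1} else 0
       let Y : Finset V → ℝ := fun A =>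
         if a 2 ∉ A ∧ a 3 ∉ A then isingCorr G Aᶜ (2 * β) 0 .free {a 2, a 3} else 0
       let E : (Finset V → ℝ) → ℝ := fun f => (∑ A : Finset V, Zs A * f A) / ∑ A : Finset V, Zs A
       let Gc : Fin 4 → Fin 4 → ℝ := fun i j => isingCorr G Finset.univ β 0 .free {a i, a j}
       isingCorr G Finset.univ β 0 .free (Finset.univ.image a)
           - (Gc 0 1 * Gc 2 3 + Gc 0 2 * Gc 1 3 + Gc 0 3 * Gc 1 2)
         = 8 * (E (fun A => X A * Y A) - E X * E Y) ∧
       Gc 0 1 = 2 * E X ∧ Gc 2 3 = 2 * E Y)) :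
    (let Zs : Finset V → ℝ := fun A =>
         isingPartitionFunction G A (2 * β) 0 .free * isingPartitionFunction G Aᶜ (2 * β) 0 .free
       let X : Finset V → ℝ := fun A =>
         if a 0 ∈ A ∧ a 1 ∈ A then isingCorr G A (2 * β) 0 .free {a 0, a 1} else 0
       let Y : Finset V → ℝ := fun A =>
         if a 2 ∉ A ∧ a 3 ∉ A then isingCorr G Aᶜ (2 * β) 0 .free {a 2, a 3} else 0
       let E : (Finset V → ℝ) → ℝ := fun f => (∑ A : Finset V, Zs A * f A) / ∑ A : Finset V, Zs A
       E (fun A => X A * Y A) ≤ (1 - c) * E X * E Y) ↔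
    (let Gc : Fin 4 → Fin 4 → ℝ := fun i j => isingCorr G Finset.univ β 0 .free {a i, a j}
     2 * c * (Gc 0 1 * Gc 2 3) ≤
       Gc 0 1 * Gc 2 3 + Gc 0 2 * Gc 1 3 + Gc 0 3 * Gc 1 2
         - isingCorr G Finset.univ β 0 .free (Finset.univ.image a)) := by
  simp only at hrep ⊢
  obtain ⟨hcov, hblue, hred⟩ := hrep
  set EX := (∑ A : Finset V, isingPartitionFunction G A (2 * β) 0 .free *
      isingPartitionFunction G Aᶜ (2 * β) 0 .free *
      (if a 0 ∈ A ∧ a 1 ∈ A then isingCorr G A (2 * β) 0 .free {a 0, a 1} else 0)) /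
    ∑ A : Finset V, isingPartitionFunction G A (2 * β) 0 .free *
      isingPartitionFunction G Aᶜ (2 * β) 0 .free with hEX
  set EY := (∑ A : Finset V, isingPartitionFunction G A (2 * β) 0 .free *
      isingPartitionFunction G Aᶜ (2 * β) 0 .free *
      (if a 2 ∉ A ∧ a 3 ∉ A then isingCorr G Aᶜ (2 * β) 0 .free {a 2, a 3} else 0)) /
    ∑ A : Finset V, isingPartitionFunction G A (2 * β) 0 .free *
      isingPartitionFunction G Aᶜ (2 * β) 0 .free with hEY
  set EXY := (∑ A : Finset V, isingPartitionFunction G A (2 * β) 0 .free *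
      isingPartitionFunction G Aᶜ (2 * β) 0 .free *
      ((if a 0 ∈ A ∧ a 1 ∈ A then isingCorr G A (2 * β) 0 .free {a 0, a 1} else 0) *
       (if a 2 ∉ A ∧ a 3 ∉ A then isingCorr G Aᶜ (2 * β) 0 .free {a 2, a 3} else 0))) /
    ∑ A : Finset V, isingPartitionFunction G A (2 * β) 0 .free *
      isingPartitionFunction G Aᶜ (2 * β) 0 .free with hEXY
  have h2 : c * (isingCorr G Finset.univ β 0 .free {a 0, a 1} *
      isingCorr G Finset.univ β 0 .free {a 2, a 3}) = 4 * (c * (EX * EY)) := by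
    rw [hblue, hred]; ring
  have h3 : (1 - c) * EX * EY = EX * EY - c * (EX * EY) := by ring
  constructor
  · intro hgain
    linarith [hcov, hgain, h2, h3]
  · intro hint
    linarith [hcov, hint, h2, h3]

end General

/-- **`stub_gain ⟺ INT`** (lattice, `β_c(3)`, tetrahedra `l·tetra ⊂ Λ_N`; same constant `c`, same
`N₀`): assuming the replica identities (`stub_replicaIdentities` of the line, Lebowitz duplicated
variables — a finite-graph identity), the sponge covariance gain C⁺ of card
`replica-sponge-shadow` is equivalent to the clause-(iii) inequality `INT` of
`Cruxes/StrandShadow/Disproof.lean` (both sides written verbatim). -/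
theorem gain_iff_int
    (hRep : ∀ (V : Type) [Fintype V] [DecidableEq V] (G : SimpleGraph V) [DecidableRel G.Adj] (β : ℝ)
      (a : Fin 4 → V), Function.Injective a →
      (let Zs : Finset V → ℝ := fun A =>
         isingPartitionFunction G A (2 * β) 0 .free * isingPartitionFunction G Aᶜ (2 * β) 0 .free
       let X : Finset V → ℝ := fun A =>
         if a 0 ∈ A ∧ a 1 ∈ A then isingCorr G A (2 * β) 0 .free {a 0, a 1} else 0
       let Y : Finset V → ℝ := fun A =>
         if a 2 ∉ A ∧ a 3 ∉ A then isingCorr G Aᶜ (2 * β) 0 .free {a 2, a 3} else 0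
       let E : (Finset V → ℝ) → ℝ := fun f => (∑ A : Finset V, Zs A * f A) / ∑ A : Finset V, Zs A
       let Gc : Fin 4 → Fin 4 → ℝ := fun i j => isingCorr G Finset.univ β 0 .free {a i, a j}
       isingCorr G Finset.univ β 0 .free (Finset.univ.image a)
           - (Gc 0 1 * Gc 2 3 + Gc 0 2 * Gc 1 3 + Gc 0 3 * Gc 1 2)
         = 8 * (E (fun A => X A * Y A) - E X * E Y) ∧
       Gc 0 1 = 2 * E X ∧ Gc 2 3 = 2 * E Y)) :
    (∃ c : ℝ, 0 < c ∧ ∀ l : ℕ, 1 ≤ l → ∃ N₀ : ℕ, ∀ N : ℕ, N₀ ≤ N → ∀ a : Fin 4 → ↥(box 3 N),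
      (∀ i, ((a i : Site 3)) = (l : ℤ) •
        (![![-1, -1, -1], ![1, 1, -1], ![1, -1, 1], ![-1, 1, 1]] : Fin 4 → Site 3) i) →
      (let G := ((zdGraph 3).comap (Subtype.val : ↥(box 3 N) → Site 3))
       let β : ℝ := criticalBeta 3
       let Zs : Finset ↥(box 3 N) → ℝ := fun A =>
         isingPartitionFunction G A (2 * β) 0 .free * isingPartitionFunction G Aᶜ (2 * β) 0 .free
       let X : Finset ↥(box 3 N) → ℝ := fun A =>
         if a 0 ∈ A ∧ a 1 ∈ A then isingCorr G A (2 * β) 0 .free {a 0, a 1} else 0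
       let Y : Finset ↥(box 3 N) → ℝ := fun A =>
         if a 2 ∉ A ∧ a 3 ∉ A then isingCorr G Aᶜ (2 * β) 0 .free {a 2, a 3} else 0
       let E : (Finset ↥(box 3 N) → ℝ) → ℝ := fun f =>
         (∑ A : Finset ↥(box 3 N), Zs A * f A) / ∑ A : Finset ↥(box 3 N), Zs A
       E (fun A => X A * Y A) ≤ (1 - c) * E X * E Y)) ↔
    (∃ c : ℝ, 0 < c ∧ ∀ l : ℕ, 1 ≤ l → ∃ N₀ : ℕ, ∀ N : ℕ, N₀ ≤ N → ∀ a : Fin 4 → ↥(box 3 N),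
      (∀ i, ((a i : Site 3)) = (l : ℤ) •
        (![![-1, -1, -1], ![1, 1, -1], ![1, -1, 1], ![-1, 1, 1]] : Fin 4 → Site 3) i) →
      (let G := (zdGraph 3).comap (Subtype.val : ↥(box 3 N) → Site 3)
       let β : ℝ := criticalBeta 3
       let Gc : Fin 4 → Fin 4 → ℝ := fun i j => isingCorr G Finset.univ β 0 .free {a i, a j}
       2 * c * (Gc 0 1 * Gc 2 3) ≤
         Gc 0 1 * Gc 2 3 + Gc 0 2 * Gc 1 3 + Gc 0 3 * Gc 1 2
           - isingCorr G Finset.univ β 0 .free (Finset.univ.image a))) := by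
  -- the four tetrahedral sources are distinct for `l ≥ 1`
  have hinj : ∀ {l : ℕ}, 1 ≤ l → ∀ {N : ℕ} (a : Fin 4 → ↥(box 3 N)),
      (∀ i, ((a i : Site 3)) = (l : ℤ) •
        (![![-1, -1, -1], ![1, 1, -1], ![1, -1, 1], ![-1, 1, 1]] : Fin 4 → Site 3) i) →
      Function.Injective a := by
    intro l hl N a ha i j hij
    have h : (l : ℤ) • (![![-1, -1, -1], ![1, 1, -1], ![1, -1, 1], ![-1, 1, 1]] : Fin 4 → Site 3) i =
        (l : ℤ) • (![![-1, -1, -1], ![1, 1, -1], ![1, -1, 1], ![-1, 1, 1]] : Fin 4 → Site 3) j := by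
      rw [← ha i, ← ha j, hij]
    have hl0 : (l : ℤ) ≠ 0 := by exact_mod_cast (show l ≠ 0 by omega)
    have h' := smul_right_injective (Site 3) hl0 h
    revert h'
    fin_cases i <;> fin_cases j <;> simp
  constructor
  · rintro ⟨c, hc, h⟩
    refine ⟨c, hc, fun l hl => ?_⟩
    obtain ⟨N₀, hN⟩ := h l hl
    refine ⟨N₀, fun N hNN a ha => ?_⟩
    have key := hN N hNN a ha
    have hrep := hRep ↥(box 3 N) ((zdGraph 3).comap (Subtype.val : ↥(box 3 N) → Site 3))
      (criticalBeta 3) a (hinj hl a ha)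
    have hiff := gain_iff_int_core (c := c)
      ((zdGraph 3).comap (Subtype.val : ↥(box 3 N) → Site 3)) a hrep
    simp only at key hiff ⊢
    exact (hiff.1 (by convert key using 12))
  · rintro ⟨c, hc, h⟩
    refine ⟨c, hc, fun l hl => ?_⟩
    obtain ⟨N₀, hN⟩ := h l hl
    refine ⟨N₀, fun N hNN a ha => ?_⟩
    have key := hN N hNN a ha
    have hrep := hRep ↥(box 3 N) ((zdGraph 3).comap (Subtype.val : ↥(box 3 N) → Site 3))
      (criticalBeta 3) a (hinj hl a ha)
    have hiff := gain_iff_int_core (c := c)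
      ((zdGraph 3).comap (Subtype.val : ↥(box 3 N) → Site 3)) a hrep
    simp only at key hiff ⊢
    convert hiff.2 key using 12

end Summit.CriticalPhenomena.Ising3DConformalLimit.Theorems.StrandShadowSketch

end
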